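import Literature.Barriers.Parity.BrunTitchmarshSiegelZeroTools
import Literature.NumberTheory.LFunctions.ZetaMulHarmonicSum
import Literature.NumberTheory.Sieve.ZetaMulSelbergSieve
import Literature.NumberTheory.Sieve.DivisorBound
import HarnessLib

/-!
# Proof of Motohashi's theorem: a uniform Brun–Titchmarsh constant `2 − ξ` excludes Siegel zeros

Topic `Literature/Barriers/Parity`. This file DISCHARGES the named fact
`Literature.Barriers.Parity.BrunTitchmarshSiegelZero` (`BrunTitchmarshSiegelZero.lean`; Motohashi,
*A note on Siegel's zeros*, Proc. Japan Acad. 55A (1979), Theorem): `BrunTitchmarshSiegelZero_holds`.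

## The argument (Motohashi's proof, pp. 190–191, in the tree's `δ = 0` rendering)

Let `χ` be the real primitive character mod `q ≥ 3`, `L(1 − δ, χ) = 0` with `0 < δ`, and assume
(1): `π(x; q, a) ≤ (2 − ξ) x/(φ(q) log(x/q))` for `x ≥ q^C`. If `δ ≥ c₀/log q` there is nothing to
prove; otherwise take `w = ⌈q^{C'}⌉ + W₀(ξ)` (`C' = max(C, 3, 16/ξ)`), `N = w^8`, and sift
`r = ζ ⋆ χ ≥ 0` on `n ≤ N` by the primes `p ≤ w` (level `w²`):

* (3), upper bound: Selberg's sieve (`ZetaMulSelbergSieve.sifted_le`) gives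
  `S ≤ N L(1,χ)/G(w) + R` with `R ≤ (ξ/8) N/log N` (divisor bound) and, by the analytic input
  `G(w) ≥ (2/5) L(1,χ)/δ − 13 q w^{-1/2} ≥ (1/5) L(1,χ)/δ` (`ZetaMulHarmonicSum.harmSum_ge`, from
  `Ψ_χ(1 − δ) = −ζ(1 − δ) L(1, χ)`), `S ≤ 5 δ N + (ξ/8) N/log N`;
* (4), lower bound: the split primes `w < p ≤ N` (`r(p) = 2`) survive, and by the prime number
  theorem, (1) summed over the `φ(q)/2` classes with `χ(a) = −1`, and `log q ≤ (ξ/128) log N`: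
  `S ≥ 2 #{w < p ≤ N : χ(p) = 1} ≥ (ξ/4) N/log N` (`BrunTitchmarshSiegelZeroTools.lean`);

whence `δ ≥ ξ/(40 log N) ≥ c/log q`. All constants depend on `ξ` and `C` only.

## Main statements

* `Motohashi1979.delta_ge_core` — the inequality `δ ≥ ξ/(40 log N)` under explicit numerical side
  conditions on `w` (the heart, steps (3)–(4));
* `Motohashi1979.exists_threshold` — the side conditions hold for `w ≥ W₀(ξ)`, `q ≤ w^{1/3}`;
* `Literature.Barriers.Parity.BrunTitchmarshSiegelZero_holds`.

## References

* Y. Motohashi, *A note on Siegel's zeros*, Proc. Japan Acad. 55A (1979) 190–192, Theorem and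
  its proof ((3), (4)). [cite: Motohashi1979SiegelZeros, Theorem (p. 190) and its proof (pp. 190–191)]
-/

noncomputable section

open Finset Filter Topology
open scoped ArithmeticFunction.omega

namespace Literature.Barriers.Parity.Motohashi1979

open Literature.NumberTheory.LFunctions Literature.NumberTheory.LFunctions.ZetaMul
  Literature.NumberTheory.LFunctions.DirichletAbel Literature.NumberTheory.Sieve
  Literature.NumberTheory.Sieve.ZetaMulSieve

variable {q : ℕ} [NeZero q] (χ : DirichletCharacter ℂ q)

/-- `log(w⁸) = 8 log w`. [folklore] -/
theorem log_pow_eight (w : ℕ) : Real.log ((w ^ 8 : ℕ) : ℝ) = 8 * Real.log w := by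
  rw [Nat.cast_pow, Real.log_pow]; norm_num

/-- `√(w⁸) = w⁴`. [folklore] -/
theorem sqrt_pow_eight (w : ℕ) : Real.sqrt ((w ^ 8 : ℕ) : ℝ) = (w : ℝ) ^ 4 := by
  rw [Nat.cast_pow, show ((w : ℝ) ^ 8) = ((w : ℝ) ^ 4) ^ 2 by ring,
    Real.sqrt_sq (by positivity)]

set_option maxHeartbeats 400000 in
/-- **The core inequality** (Motohashi's (3) + (4) with explicit constants). Let `χ ≠ 1` be
quadratic mod `q ≥ 3`, `0 < ξ ≤ 1`, `w ≥ 3`, `N = w⁸`, `L(1 − δ, χ) = 0` with `0 < δ ≤ 1/10` and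
`δ log w ≤ 1/2`; assume (1) at `x = N` with constant `2 − ξ`, `log q ≤ (ξ/16) log w`, the prime
number theorem at `N` with relative error `ξ/16`, and the smallness conditions `hsmall₁–₃`, `hErr`
(the Selberg remainder `∑_{d ≤ w², d squarefree} 3^{ω(d)} τ(d)² · 5q√(N/d) ≤ (ξ/8) N/log N`).
Then `δ ≥ ξ/(40 log N)`. [cite: Motohashi1979SiegelZeros, proof of the Theorem, (3)–(4)] -/
theorem delta_ge_core (hχ : χ ≠ 1) (hq : χ ^ 2 = 1) {ξ δ : ℝ} (hξ : 0 < ξ) (hξ1 : ξ ≤ 1)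
    {w : ℕ} (hw : 3 ≤ w) (hq3 : 3 ≤ q)
    (hδ : 0 < δ) (hδ1 : δ ≤ 1 / 10) (h0 : χ.LFunction ((1 - δ : ℝ) : ℂ) = 0)
    (hδw : δ * Real.log w ≤ 1 / 2)
    (hBT : ∀ a : ℕ, a.Coprime q →
      (LevelOfDistribution.primeCountingMod q a (w ^ 8) : ℝ) ≤
        (2 - ξ) * ((w ^ 8 : ℕ) : ℝ) / (Nat.totient q * Real.log (((w ^ 8 : ℕ) : ℝ) / q)))
    (hlogq : Real.log q ≤ ξ / 16 * Real.log w)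
    (hPNT : (1 - ξ / 16) * ((w ^ 8 : ℕ) : ℝ) ≤
      (((Ioc 0 (w ^ 8)).filter Nat.Prime).card : ℝ) * Real.log ((w ^ 8 : ℕ) : ℝ))
    (hsmall₁ : ((w : ℝ) + q) * Real.log ((w ^ 8 : ℕ) : ℝ) ≤ ξ / 16 * ((w ^ 8 : ℕ) : ℝ))
    (hsmall₂ : 5 * q * Real.log ((w ^ 8 : ℕ) : ℝ) ≤ ξ / 10 * Real.sqrt ((w ^ 8 : ℕ) : ℝ))
    (hsmall₃ : 13 * q * (w : ℝ) ^ (-(1 / 2 : ℝ)) ≤ ξ / 200)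
    (hErr : ∑ d ∈ (Ioc 0 (w ^ 2)).filter Squarefree,
      (3 : ℝ) ^ ω d * (((d.divisors.card : ℝ)) ^ 2 * (5 * q * Real.sqrt (((w ^ 8 : ℕ) : ℝ) / d))) ≤
      ξ / 8 * ((w ^ 8 : ℕ) : ℝ) / Real.log ((w ^ 8 : ℕ) : ℝ)) :
    ξ / (40 * Real.log ((w ^ 8 : ℕ) : ℝ)) ≤ δ := by
  classical
  set N : ℕ := w ^ 8 with hNdef
  set L : ℝ := Real.log (N : ℝ) with hLdef
  have hw1 : 1 ≤ w := by omega
  have hw0 : (0 : ℝ) < w := by exact_mod_cast (show 0 < w by omega)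
  have hlogw : 1 < Real.log w := by
    have h3 : (1 : ℝ) < Real.log 3 := by
      rw [Real.lt_log_iff_exp_lt (by norm_num)]; linarith [Real.exp_one_lt_d9]
    exact h3.trans_le (Real.log_le_log (by norm_num) (by exact_mod_cast hw))
  have hL : L = 8 * Real.log w := log_pow_eight w
  have hLpos : 0 < L := by rw [hL]; linarith
  have hN0 : (0 : ℝ) < N := by rw [hNdef]; positivity
  have hqpos : (0 : ℝ) < q := by exact_mod_cast (show 0 < q by omega)
  have hLOne := LOne_pos χ hχ hq
  -- (b) `log(N/q) ≥ (1 − ξ/128) L > 0`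
  have hlogNq : (1 - ξ / 128) * L ≤ Real.log ((N : ℝ) / q) := by
    rw [Real.log_div hN0.ne' hqpos.ne', hL]; linarith
  have hlogNq0 : 0 < Real.log ((N : ℝ) / q) := lt_of_lt_of_le (by nlinarith) hlogNq
  set X : ℝ := (N : ℝ) / L with hXdef
  have hX0 : 0 ≤ X := by positivity
  -- (c) the inert primes: `#inert ≤ (1 − ξ/4) X`
  have hinert : ((inertPrimes χ N).card : ℝ) ≤ (1 - ξ / 4) * X := by
    have h1 := card_inertPrimes_le χ hχ hq hBT
    have hpos : 0 ≤ (1 - ξ / 2) * (N : ℝ) := by nlinarith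
    calc ((inertPrimes χ N).card : ℝ) ≤ (1 - ξ / 2) * N / Real.log ((N : ℝ) / q) := h1
      _ ≤ (1 - ξ / 2) * N / ((1 - ξ / 128) * L) :=
          div_le_div_of_nonneg_left hpos (by nlinarith) hlogNq
      _ = (1 - ξ / 2) / (1 - ξ / 128) * X := by rw [hXdef]; field_simp
      _ ≤ (1 - ξ / 4) * X := by
          refine mul_le_mul_of_nonneg_right ?_ hX0
          rw [div_le_iff₀ (by nlinarith)]
          nlinarith
  -- (d)+(e) the split primes: `#split ≥ (ξ/8) X`
  have hsplit : ξ / 8 * X ≤ ((splitPrimes χ w N).card : ℝ) := by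
    have h1 := card_primes_le_card_splitPrimes_add χ hq w N
    have hprimes : (1 - ξ / 16) * X ≤ (((Ioc 0 N).filter Nat.Prime).card : ℝ) := by
      rw [hXdef, ← mul_div_assoc, div_le_iff₀ hLpos]; exact hPNT
    have hwq : (w : ℝ) + q ≤ ξ / 16 * X := by
      rw [hXdef, ← mul_div_assoc, le_div_iff₀ hLpos]; exact hsmall₁
    linarith
  -- (f) the sifted sum from below: `S ≥ (ξ/4) X`
  set S := ∑ n ∈ (Ioc 0 N).filter (fun n : ℕ => n.Coprime (primesProdBelow ((w : ℝ) + 1))), coeff χ n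
    with hSdef
  have hSge : ξ / 4 * X ≤ S := by
    have := two_mul_card_splitPrimes_le_sifted χ hq w N
    rw [← hSdef] at this
    linarith
  -- (g) `L(1,χ) ≥ ξ/(10 L)`
  have hL1 : ξ / 10 / L ≤ LOne χ := by
    have hconv : ξ / 4 * X ≤ convSum χ N := by
      have := two_mul_card_splitPrimes_le_convSum χ hq w N
      linarith
    have hmv : convSum χ N ≤ N * LOne χ + 5 * q * Real.sqrt N := by
      have := (abs_le.mp (abs_convSum_sub_le χ hχ hq N)).2; linarith
    have hsq0 : 0 < Real.sqrt N := Real.sqrt_pos.mpr hN0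
    -- `5q√N ≤ (ξ/10) X`
    have h5 : 5 * q * Real.sqrt N ≤ ξ / 10 * X := by
      rw [hXdef, ← mul_div_assoc, le_div_iff₀ hLpos]
      have h := mul_le_mul_of_nonneg_right hsmall₂ hsq0.le
      have e : ξ / 10 * Real.sqrt (N : ℝ) * Real.sqrt N = ξ / 10 * N := by
        rw [mul_assoc, Real.mul_self_sqrt hN0.le]
      rw [e] at h
      linarith
    have hξX : 0 ≤ ξ * X := mul_nonneg hξ.le hX0
    have hNL : ξ / 10 * X ≤ N * LOne χ := by linarith
    have hNL' : ξ / 10 / L * N ≤ LOne χ * N := by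
      have e : ξ / 10 / L * N = ξ / 10 * X := by rw [hXdef]; ring
      rw [e, mul_comm (LOne χ)]; exact hNL
    exact le_of_mul_le_mul_right hNL' hN0
  -- (h) the harmonic sum: `G(w) ≥ L₁/(5δ)`
  have hharm : LOne χ / (5 * δ) ≤ harmSum χ w := by
    have h := harmSum_ge χ hχ hq hδ hδ1 h0 hw1 hδw
    -- `1/δ ≥ 2 log w = L/4`, so `L₁/δ ≥ ξ/40`
    have hinvδ : L / 4 ≤ 1 / δ := by
      rw [hL, div_le_div_iff₀ (by norm_num) hδ]; nlinarith
    have hL1δ : ξ / 40 ≤ LOne χ / δ := by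
      calc ξ / 40 = ξ / 10 / L * (L / 4) := by field_simp; ring
        _ ≤ LOne χ * (1 / δ) := mul_le_mul hL1 hinvδ (by positivity) hLOne.le
        _ = LOne χ / δ := by ring
    have htail : 13 * q * (w : ℝ) ^ (-(1 / 2 : ℝ)) ≤ 1 / 5 * (LOne χ / δ) := by linarith
    have e : LOne χ / (5 * δ) = 2 / 5 * (LOne χ / δ) - 1 / 5 * (LOne χ / δ) := by ring
    rw [e]; linarith
  have hharm0 : 0 < LOne χ / (5 * δ) := by positivity
  -- (i) the sieve from above: `S ≤ 5δN + (ξ/8) X`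
  have hSle : S ≤ 5 * δ * N + ξ / 8 * X := by
    have hsieve := sifted_le χ hχ hq N hw1
    rw [← hSdef] at hsieve
    have hmain : (N : ℝ) * LOne χ / (∑ n ∈ Ioc 0 w, coeff χ n / n) ≤ 5 * δ * N := by
      have hG : LOne χ / (5 * δ) ≤ ∑ n ∈ Ioc 0 w, coeff χ n / n := hharm
      calc (N : ℝ) * LOne χ / (∑ n ∈ Ioc 0 w, coeff χ n / n)
          ≤ (N : ℝ) * LOne χ / (LOne χ / (5 * δ)) :=
            div_le_div_of_nonneg_left (by positivity) hharm0 hG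
        _ = 5 * δ * N := by field_simp
    have e : ξ / 8 * X = ξ / 8 * ((w ^ 8 : ℕ) : ℝ) / Real.log ((w ^ 8 : ℕ) : ℝ) := by
      rw [hXdef, ← mul_div_assoc]
    rw [← e] at hErr
    linarith
  -- (j) combine: `(ξ/8) X ≤ 5δN`, i.e. `δ ≥ ξ/(40 L)`
  have hfinal : ξ / 8 * X ≤ 5 * δ * N := by linarith
  have h1 : ξ / 8 / L * N ≤ 5 * δ * N := by
    have e : ξ / 8 / L * N = ξ / 8 * X := by rw [hXdef]; ring
    rw [e]; exact hfinal
  have h2 : ξ / 8 / L ≤ 5 * δ := le_of_mul_le_mul_right h1 hN0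
  have h3 : ξ / 8 ≤ 5 * δ * L := (div_le_iff₀ hLpos).mp h2
  rw [div_le_iff₀ (by positivity)]
  ring_nf at h3 ⊢
  linarith

/-- **The side conditions hold for large `w`**: for `0 < ξ` there is `W₀ ≥ 3` such that for all
`w ≥ W₀` and all `1 ≤ q ≤ w^{1/3}`: the prime number theorem at `N = w⁸` with relative error `ξ/16`,
`(w + q) log N ≤ (ξ/16) N`, `5q log N ≤ (ξ/10)√N`, `13 q w^{-1/2} ≤ ξ/200`, and the Selberg
remainder `∑_{d ≤ w², d sqfree} 3^{ω(d)} τ(d)² 5q√(N/d) ≤ (ξ/8) N/log N` (divisor bound `τ(d) ≤ C_τ d^{1/16}`).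
[folklore] -/
theorem exists_threshold {ξ : ℝ} (hξ : 0 < ξ) :
    ∃ W₀ : ℕ, 3 ≤ W₀ ∧ ∀ w : ℕ, W₀ ≤ w → ∀ q : ℕ, 1 ≤ q → (q : ℝ) ≤ (w : ℝ) ^ (1 / 3 : ℝ) →
      (1 - ξ / 16) * ((w ^ 8 : ℕ) : ℝ) ≤
          (((Ioc 0 (w ^ 8)).filter Nat.Prime).card : ℝ) * Real.log ((w ^ 8 : ℕ) : ℝ) ∧
      ((w : ℝ) + q) * Real.log ((w ^ 8 : ℕ) : ℝ) ≤ ξ / 16 * ((w ^ 8 : ℕ) : ℝ) ∧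
      5 * q * Real.log ((w ^ 8 : ℕ) : ℝ) ≤ ξ / 10 * Real.sqrt ((w ^ 8 : ℕ) : ℝ) ∧
      13 * q * (w : ℝ) ^ (-(1 / 2 : ℝ)) ≤ ξ / 200 ∧
      ∑ d ∈ (Ioc 0 (w ^ 2)).filter Squarefree,
        (3 : ℝ) ^ ω d * (((d.divisors.card : ℝ)) ^ 2 * (5 * q * Real.sqrt (((w ^ 8 : ℕ) : ℝ) / d))) ≤
        ξ / 8 * ((w ^ 8 : ℕ) : ℝ) / Real.log ((w ^ 8 : ℕ) : ℝ) := by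
  classical
  obtain ⟨N₁, hN₁⟩ := exists_card_primes_ge (ε := ξ / 16) (by positivity)
  obtain ⟨Cτ, hCτ1, hCτ⟩ := exists_card_divisors_le_mul_rpow (ε := (1 / 16 : ℝ)) (by norm_num)
  have E1 := eventually_mul_rpow_mul_log_le (a := 1) (b := 8) (K := 16) (ε := ξ / 16)
    (by norm_num) (by norm_num) (by positivity)
  have E2 := eventually_mul_rpow_mul_log_le (a := 1 / 3) (b := 4) (K := 40) (ε := ξ / 10)
    (by norm_num) (by norm_num) (by positivity)
  have E3 := eventually_mul_rpow_mul_log_le (a := -(1 / 6)) (b := 0) (K := 13) (ε := ξ / 200)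
    (by norm_num) (by norm_num) (by positivity)
  have E4 := eventually_mul_rpow_mul_log_le (a := 41 / 6) (b := 8) (K := 5 * Cτ ^ 4) (ε := ξ / 64)
    (by norm_num) (by positivity) (by positivity)
  simp only [Real.rpow_ofNat, Real.rpow_one, Real.rpow_zero, mul_one] at E1 E2 E3 E4
  obtain ⟨W, hW⟩ := Filter.eventually_atTop.mp (E1.and (E2.and (E3.and E4)))
  refine ⟨max (max W N₁) 3, le_max_right _ _, fun w hw q hq1 hqw => ?_⟩
  have hwW : W ≤ w := le_trans (le_trans (le_max_left _ _) (le_max_left _ _)) hw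
  have hwN₁ : N₁ ≤ w := le_trans (le_trans (le_max_right _ _) (le_max_left _ _)) hw
  have hw3 : 3 ≤ w := le_trans (le_max_right _ _) hw
  obtain ⟨e1, e2, e3, e4⟩ := hW w hwW
  have hw0 : (0 : ℝ) < w := by exact_mod_cast (show 0 < w by omega)
  have hw1 : (1 : ℝ) ≤ w := by exact_mod_cast (show 1 ≤ w by omega)
  have hlogw : 1 < Real.log w := by
    have h3 : (1 : ℝ) < Real.log 3 := by
      rw [Real.lt_log_iff_exp_lt (by norm_num)]; linarith [Real.exp_one_lt_d9]
    exact h3.trans_le (Real.log_le_log (by norm_num) (by exact_mod_cast hw3))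
  have hL : Real.log ((w ^ 8 : ℕ) : ℝ) = 8 * Real.log w := log_pow_eight w
  have hN : ((w ^ 8 : ℕ) : ℝ) = (w : ℝ) ^ 8 := by rw [Nat.cast_pow]
  have hlogw0 : 0 ≤ Real.log w := by linarith
  have hq0 : (0 : ℝ) ≤ q := Nat.cast_nonneg q
  have hq13 : (q : ℝ) ≤ (w : ℝ) ^ (1 / 3 : ℝ) := hqw
  have hw13 : (w : ℝ) ^ (1 / 3 : ℝ) ≤ w := by
    conv_rhs => rw [← Real.rpow_one (w : ℝ)]
    exact Real.rpow_le_rpow_of_exponent_le hw1 (by norm_num)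
  have hqw' : (q : ℝ) ≤ w := hq13.trans hw13
  refine ⟨?_, ?_, ?_, ?_, ?_⟩
  · -- PNT at `N = w⁸ ≥ w ≥ N₁`
    exact hN₁ (w ^ 8) (hwN₁.trans (Nat.le_self_pow (by norm_num) w))
  · -- `(w + q) · 8 log w ≤ 16 w log w ≤ (ξ/16) w⁸`
    rw [hL, hN]
    have hql : (q : ℝ) * Real.log w ≤ w * Real.log w := mul_le_mul_of_nonneg_right hqw' hlogw0
    have e : ((w : ℝ) + q) * (8 * Real.log w) = 8 * (w * Real.log w) + 8 * (q * Real.log w) := by ring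
    rw [e]
    have e1' : 16 * ((w : ℝ) * Real.log w) ≤ ξ / 16 * (w : ℝ) ^ 8 := by
      have := e1; ring_nf at this ⊢; linarith
    linarith
  · -- `5 q · 8 log w ≤ 40 w^{1/3} log w ≤ (ξ/10) w⁴ = (ξ/10) √(w⁸)`
    rw [hL, sqrt_pow_eight]
    have hql : (q : ℝ) * Real.log w ≤ (w : ℝ) ^ (1 / 3 : ℝ) * Real.log w :=
      mul_le_mul_of_nonneg_right hq13 hlogw0
    have e : 5 * (q : ℝ) * (8 * Real.log w) = 40 * (q * Real.log w) := by ring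
    have e' : 40 * (w : ℝ) ^ (1 / 3 : ℝ) * Real.log w = 40 * ((w : ℝ) ^ (1 / 3 : ℝ) * Real.log w) := by
      ring
    rw [e]
    rw [e'] at e2
    linarith
  · -- `13 q w^{-1/2} ≤ 13 w^{-1/6} ≤ 13 w^{-1/6} log w ≤ ξ/200`
    have hexp : (q : ℝ) * (w : ℝ) ^ (-(1 / 2 : ℝ)) ≤ (w : ℝ) ^ (-(1 / 6 : ℝ)) := by
      calc (q : ℝ) * (w : ℝ) ^ (-(1 / 2 : ℝ)) ≤ (w : ℝ) ^ (1 / 3 : ℝ) * (w : ℝ) ^ (-(1 / 2 : ℝ)) :=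
            mul_le_mul_of_nonneg_right hq13 (by positivity)
        _ = (w : ℝ) ^ (-(1 / 6 : ℝ)) := by rw [← Real.rpow_add hw0]; norm_num
    have hpos : 0 ≤ (w : ℝ) ^ (-(1 / 6 : ℝ)) := by positivity
    calc 13 * (q : ℝ) * (w : ℝ) ^ (-(1 / 2 : ℝ)) = 13 * ((q : ℝ) * (w : ℝ) ^ (-(1 / 2 : ℝ))) := by ring
      _ ≤ 13 * (w : ℝ) ^ (-(1 / 6 : ℝ)) := by linarith
      _ = 13 * (w : ℝ) ^ (-(1 / 6 : ℝ)) * 1 := by ring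
      _ ≤ 13 * (w : ℝ) ^ (-(1 / 6 : ℝ)) * Real.log w :=
          mul_le_mul_of_nonneg_left hlogw.le (by positivity)
      _ ≤ ξ / 200 := e3
  · -- the error term
    have hterm : ∀ d ∈ (Ioc 0 (w ^ 2)).filter Squarefree,
        (3 : ℝ) ^ ω d * (((d.divisors.card : ℝ)) ^ 2 *
          (5 * q * Real.sqrt (((w ^ 8 : ℕ) : ℝ) / d))) ≤
          5 * Cτ ^ 4 * ((w : ℝ) ^ (1 / 2 : ℝ) * ((w : ℝ) ^ (1 / 3 : ℝ) * (w : ℝ) ^ 4)) := by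
      intro d hd
      rw [Finset.mem_filter, Finset.mem_Ioc] at hd
      have hd0 : d ≠ 0 := by omega
      have hd1 : (1 : ℝ) ≤ d := by exact_mod_cast hd.1.1
      have hdw : (d : ℝ) ≤ (w : ℝ) ^ 2 := by exact_mod_cast hd.1.2
      -- `3^ω τ² ≤ τ⁴ ≤ Cτ⁴ d^{1/4} ≤ Cτ⁴ w^{1/2}`
      have hτ := hCτ d hd0
      have h3 := three_pow_cardDistinctFactors_le hd0
      have hτ4 : ((d.divisors.card : ℝ)) ^ 4 ≤ Cτ ^ 4 * (w : ℝ) ^ (1 / 2 : ℝ) := by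
        calc ((d.divisors.card : ℝ)) ^ 4 ≤ (Cτ * (d : ℝ) ^ (1 / 16 : ℝ)) ^ 4 :=
              pow_le_pow_left₀ (by positivity) hτ 4
          _ = Cτ ^ 4 * ((d : ℝ) ^ (1 / 16 : ℝ)) ^ 4 := by ring
          _ = Cτ ^ 4 * (d : ℝ) ^ (1 / 4 : ℝ) := by
              rw [← Real.rpow_natCast ((d : ℝ) ^ (1 / 16 : ℝ)) 4, ← Real.rpow_mul (by positivity)]
              norm_num
          _ ≤ Cτ ^ 4 * ((w : ℝ) ^ 2) ^ (1 / 4 : ℝ) := by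
              gcongr
          _ = Cτ ^ 4 * (w : ℝ) ^ (1 / 2 : ℝ) := by
              rw [← Real.rpow_natCast (w : ℝ) 2, ← Real.rpow_mul hw0.le]; norm_num
      -- `5q√(N/d) ≤ 5 q w⁴ ≤ 5 w^{1/3} w⁴`
      have hsq : Real.sqrt (((w ^ 8 : ℕ) : ℝ) / d) ≤ (w : ℝ) ^ 4 := by
        rw [← sqrt_pow_eight]
        exact Real.sqrt_le_sqrt (div_le_self (by positivity) hd1)
      have hin : 5 * q * Real.sqrt (((w ^ 8 : ℕ) : ℝ) / d) ≤ 5 * ((w : ℝ) ^ (1 / 3 : ℝ) * (w : ℝ) ^ 4) := by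
        rw [mul_assoc]
        exact mul_le_mul_of_nonneg_left (mul_le_mul hq13 hsq (by positivity) (by positivity))
          (by norm_num)
      calc (3 : ℝ) ^ ω d * (((d.divisors.card : ℝ)) ^ 2 * (5 * q * Real.sqrt (((w ^ 8 : ℕ) : ℝ) / d)))
          ≤ ((d.divisors.card : ℝ)) ^ 2 * (((d.divisors.card : ℝ)) ^ 2 *
              (5 * q * Real.sqrt (((w ^ 8 : ℕ) : ℝ) / d))) :=
            mul_le_mul_of_nonneg_right h3 (by positivity)
        _ = ((d.divisors.card : ℝ)) ^ 4 * (5 * q * Real.sqrt (((w ^ 8 : ℕ) : ℝ) / d)) := by ring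
        _ ≤ (Cτ ^ 4 * (w : ℝ) ^ (1 / 2 : ℝ)) * (5 * ((w : ℝ) ^ (1 / 3 : ℝ) * (w : ℝ) ^ 4)) :=
            mul_le_mul hτ4 hin (by positivity) (by positivity)
        _ = 5 * Cτ ^ 4 * ((w : ℝ) ^ (1 / 2 : ℝ) * ((w : ℝ) ^ (1 / 3 : ℝ) * (w : ℝ) ^ 4)) := by ring
    have hcard : (((Ioc 0 (w ^ 2)).filter Squarefree).card : ℝ) ≤ (w : ℝ) ^ 2 := by
      have h : ((Ioc 0 (w ^ 2)).filter Squarefree).card ≤ w ^ 2 :=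
        (Finset.card_filter_le (Ioc 0 (w ^ 2)) Squarefree).trans (by simp)
      exact_mod_cast h
    have hsum : ∑ d ∈ (Ioc 0 (w ^ 2)).filter Squarefree,
        (3 : ℝ) ^ ω d * (((d.divisors.card : ℝ)) ^ 2 * (5 * q * Real.sqrt (((w ^ 8 : ℕ) : ℝ) / d))) ≤ (w : ℝ) ^ 2 *
        (5 * Cτ ^ 4 * ((w : ℝ) ^ (1 / 2 : ℝ) * ((w : ℝ) ^ (1 / 3 : ℝ) * (w : ℝ) ^ 4))) := by
      refine (Finset.sum_le_sum hterm).trans ?_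
      rw [Finset.sum_const, nsmul_eq_mul]
      exact mul_le_mul_of_nonneg_right hcard (by positivity)
    -- `w² · w^{1/2} · w^{1/3} · w⁴ = w^{41/6}`
    have hpow : (w : ℝ) ^ 2 * (5 * Cτ ^ 4 * ((w : ℝ) ^ (1 / 2 : ℝ) * ((w : ℝ) ^ (1 / 3 : ℝ) * (w : ℝ) ^ 4))) =
        5 * Cτ ^ 4 * (w : ℝ) ^ (41 / 6 : ℝ) := by
      rw [← Real.rpow_natCast (w : ℝ) 2, ← Real.rpow_natCast (w : ℝ) 4]
      have e : (w : ℝ) ^ (41 / 6 : ℝ) = (w : ℝ) ^ ((2 : ℕ) : ℝ) * ((w : ℝ) ^ (1 / 2 : ℝ) *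
          ((w : ℝ) ^ (1 / 3 : ℝ) * (w : ℝ) ^ ((4 : ℕ) : ℝ))) := by
        rw [← Real.rpow_add hw0, ← Real.rpow_add hw0, ← Real.rpow_add hw0]; norm_num
      rw [e]; ring
    rw [hpow] at hsum
    refine hsum.trans ?_
    -- `5 Cτ⁴ w^{41/6} ≤ (ξ/64) w⁸ / log w`, i.e. `5Cτ⁴ w^{41/6} log w ≤ (ξ/64) w⁸`
    rw [hL, hN, le_div_iff₀ (by positivity)]
    have e : 5 * Cτ ^ 4 * (w : ℝ) ^ (41 / 6 : ℝ) * (8 * Real.log w) =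
        8 * (5 * Cτ ^ 4 * (w : ℝ) ^ (41 / 6 : ℝ) * Real.log w) := by ring
    rw [e]
    linarith

end Literature.Barriers.Parity.Motohashi1979

namespace Literature.Barriers.Parity

open Motohashi1979 Literature.NumberTheory.LFunctions.ZetaMul

set_option maxHeartbeats 400000 in
/-- **Motohashi's theorem** (discharge of `BrunTitchmarshSiegelZero`): for every `ξ > 0` and every
range exponent `C ≥ 2` there is `c = c(ξ, C) > 0` such that, for every modulus `q ≥ 3` for which the
Brun–Titchmarsh inequality holds with constant `2 − ξ` for all `x ≥ q^C` and all reduced classes,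
every real zero `σ ∈ [1/2, 1)` of `L(s, χ)`, `χ` the quadratic primitive character mod `q`, satisfies
`σ ≤ 1 − c/log q`. Proof: Selberg's sieve on `ζ ⋆ χ` at `N = w⁸`, `w = ⌈q^{C'}⌉ + W₀`
(`delta_ge_core`, `exists_threshold`), after the reductions `ξ ↦ min(ξ, 1)`,
`C' = max(C, 3, 16/ξ)`, and the trivial case `1 − σ ≥ c₀/log q`.
[cite: Motohashi1979SiegelZeros, Theorem (p. 190) and its proof (pp. 190–191)] -/
theorem BrunTitchmarshSiegelZero_holds : BrunTitchmarshSiegelZero := by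
  classical
  intro ξ₀ hξ₀ C hC
  set ξ : ℝ := min ξ₀ 1 with hξdef
  have hξ : 0 < ξ := lt_min hξ₀ one_pos
  have hξ1 : ξ ≤ 1 := min_le_right _ _
  have hξle : ξ ≤ ξ₀ := min_le_left _ _
  set C' : ℝ := max C (max 3 (16 / ξ)) with hC'def
  have hC'C : C ≤ C' := le_max_left _ _
  have hC'3 : 3 ≤ C' := le_trans (le_max_left _ _) (le_max_right _ _)
  have hC'ξ : 16 / ξ ≤ C' := le_trans (le_max_right _ _) (le_max_right _ _)
  have hC'0 : 0 < C' := by linarith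
  obtain ⟨W₀, hW₀3, hW⟩ := exists_threshold hξ
  set A : ℝ := C' + Real.log (2 + W₀) with hAdef
  have hlogW : 0 ≤ Real.log (2 + (W₀ : ℝ)) := Real.log_nonneg (by linarith [(Nat.cast_nonneg W₀ : (0:ℝ) ≤ W₀)])
  have hA3 : 3 ≤ A := by rw [hAdef]; linarith
  have hA0 : 0 < A := by linarith
  set c₀ : ℝ := 1 / (4 * A) with hc₀def
  have hc₀ : 0 < c₀ := by positivity
  have hc₀le : c₀ ≤ 1 / 12 := by
    rw [hc₀def, div_le_div_iff₀ (by positivity) (by norm_num)]; nlinarith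
  set c : ℝ := min c₀ (ξ / (320 * A)) with hcdef
  have hc : 0 < c := lt_min hc₀ (by positivity)
  refine ⟨c, hc, ?_⟩
  intro q _ hq3 hBT χ hquad hprim σ hσ hσ1 hL0
  have hq2 : χ ^ 2 = 1 := MulChar.isQuadratic_iff_sq_eq_one.mp hquad
  have hχ : χ ≠ 1 := ne_one_of_isPrimitive (by omega) hprim
  have hq1 : (1 : ℝ) < q := by exact_mod_cast (show 1 < q by omega)
  have hqpos : (0 : ℝ) < q := by linarith
  have hlogq1 : 1 ≤ Real.log q := by
    have h3 : (1 : ℝ) < Real.log 3 := by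
      rw [Real.lt_log_iff_exp_lt (by norm_num)]; linarith [Real.exp_one_lt_d9]
    exact le_trans h3.le (Real.log_le_log (by norm_num) (by exact_mod_cast hq3))
  have hlogq0 : 0 < Real.log q := by linarith
  set δ : ℝ := 1 - σ with hδdef
  have hδ0 : 0 < δ := by rw [hδdef]; linarith
  -- it suffices to show `c / log q ≤ δ`
  suffices hgoal : c / Real.log q ≤ δ by rw [hδdef] at hgoal; linarith
  by_cases hcase : c₀ / Real.log q ≤ δ
  · exact le_trans (div_le_div_of_nonneg_right (min_le_left _ _) hlogq0.le) hcase
  push Not at hcase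
  -- the main case: `δ < c₀ / log q`
  have hδc₀ : δ ≤ c₀ := hcase.le.trans (div_le_self hc₀.le hlogq1)
  have hδ10 : δ ≤ 1 / 10 := by linarith
  -- the parameter `w`
  set w : ℕ := ⌈(q : ℝ) ^ C'⌉₊ + W₀ with hwdef
  have hwW : W₀ ≤ w := Nat.le_add_left _ _
  have hw3 : 3 ≤ w := hW₀3.trans hwW
  have hw1 : 1 ≤ w := by omega
  have hw0 : (0 : ℝ) < w := by exact_mod_cast (show 0 < w by omega)
  have hqC' : (q : ℝ) ^ C' ≤ w := by
    rw [hwdef]; push_cast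
    linarith [Nat.le_ceil ((q : ℝ) ^ C'), (Nat.cast_nonneg W₀ : (0 : ℝ) ≤ W₀)]
  have hqC'1 : (1 : ℝ) ≤ (q : ℝ) ^ C' := Real.one_le_rpow hq1.le hC'0.le
  -- `q ≤ w^{1/3}`
  have hq13 : (q : ℝ) ≤ (w : ℝ) ^ (1 / 3 : ℝ) := by
    have h3 : (q : ℝ) ^ (3 : ℝ) ≤ w :=
      (Real.rpow_le_rpow_of_exponent_le hq1.le hC'3).trans hqC'
    calc (q : ℝ) = ((q : ℝ) ^ (3 : ℝ)) ^ (1 / 3 : ℝ) := by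
          rw [← Real.rpow_mul hqpos.le]; norm_num
      _ ≤ (w : ℝ) ^ (1 / 3 : ℝ) := Real.rpow_le_rpow (by positivity) h3 (by norm_num)
  -- `log q ≤ (ξ/16) log w`
  have hlogw0 : 0 ≤ Real.log w := Real.log_nonneg (by exact_mod_cast hw1)
  have hlogq : Real.log q ≤ ξ / 16 * Real.log w := by
    have h1 : C' * Real.log q ≤ Real.log w := by
      rw [← Real.log_rpow hqpos]
      exact Real.log_le_log (by positivity) hqC'
    have h2 : Real.log q ≤ Real.log w / C' := by rw [le_div_iff₀ hC'0]; linarith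
    refine h2.trans ?_
    rw [div_le_iff₀ hC'0]
    have : 16 ≤ ξ * C' := by rw [div_le_iff₀ hξ] at hC'ξ; linarith
    nlinarith
  -- `log w ≤ A log q`
  have hlogwA : Real.log w ≤ A * Real.log q := by
    have hwle : (w : ℝ) ≤ (2 + W₀) * (q : ℝ) ^ C' := by
      rw [hwdef]; push_cast
      have := Nat.ceil_lt_add_one (show (0 : ℝ) ≤ (q : ℝ) ^ C' by positivity)
      nlinarith [(Nat.cast_nonneg W₀ : (0 : ℝ) ≤ W₀)]
    calc Real.log w ≤ Real.log ((2 + W₀) * (q : ℝ) ^ C') := Real.log_le_log hw0 hwle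
      _ = Real.log (2 + W₀) + C' * Real.log q := by
          rw [Real.log_mul (by positivity) (by positivity), Real.log_rpow hqpos]
      _ ≤ Real.log (2 + W₀) * Real.log q + C' * Real.log q := by nlinarith
      _ = A * Real.log q := by rw [hAdef]; ring
  -- `δ log w ≤ 1/2`
  have hδw : δ * Real.log w ≤ 1 / 2 := by
    calc δ * Real.log w ≤ c₀ / Real.log q * (A * Real.log q) :=
          mul_le_mul hcase.le hlogwA hlogw0 (by positivity)
      _ = c₀ * A := by field_simp
      _ = 1 / 4 := by rw [hc₀def]; field_simp
      _ ≤ 1 / 2 := by norm_num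
  -- the zero at `1 − δ = σ`
  have h0 : χ.LFunction ((1 - δ : ℝ) : ℂ) = 0 := by
    rw [show (1 - δ : ℝ) = σ by rw [hδdef]; ring]; exact hL0
  -- Brun–Titchmarsh at `x = N = w⁸` with constant `2 − ξ`
  have hN : (q : ℝ) ^ C ≤ ((w ^ 8 : ℕ) : ℝ) := by
    calc (q : ℝ) ^ C ≤ (q : ℝ) ^ C' := Real.rpow_le_rpow_of_exponent_le hq1.le hC'C
      _ ≤ w := hqC'
      _ ≤ ((w ^ 8 : ℕ) : ℝ) := by exact_mod_cast Nat.le_self_pow (by norm_num) w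
  have hNq : 0 < Real.log (((w ^ 8 : ℕ) : ℝ) / q) := by
    apply Real.log_pos
    rw [one_lt_div hqpos]
    calc (q : ℝ) < (q : ℝ) ^ (3 : ℝ) := by
          conv_lhs => rw [← Real.rpow_one (q : ℝ)]
          exact Real.rpow_lt_rpow_of_exponent_lt hq1 (by norm_num)
      _ ≤ (q : ℝ) ^ C' := Real.rpow_le_rpow_of_exponent_le hq1.le hC'3
      _ ≤ w := hqC'
      _ ≤ ((w ^ 8 : ℕ) : ℝ) := by exact_mod_cast Nat.le_self_pow (by norm_num) w
  have hBTN : ∀ a : ℕ, a.Coprime q →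
      (Literature.NumberTheory.Sieve.LevelOfDistribution.primeCountingMod q a (w ^ 8) : ℝ) ≤
        (2 - ξ) * ((w ^ 8 : ℕ) : ℝ) / (Nat.totient q * Real.log (((w ^ 8 : ℕ) : ℝ) / q)) := by
    intro a ha
    refine (hBT a ha (w ^ 8) hN).trans ?_
    exact div_le_div_of_nonneg_right (mul_le_mul_of_nonneg_right (by linarith) (by positivity))
      (mul_nonneg (Nat.cast_nonneg _) hNq.le)
  -- the side conditions
  obtain ⟨hP, h1, h2, h3, h4⟩ := hW w hwW q (by omega) hq13
  -- the core
  have hcore := delta_ge_core χ hχ hq2 hξ hξ1 hw3 hq3 hδ0 hδ10 h0 hδw hBTN hlogq hP h1 h2 h3 h4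
  -- `c/log q ≤ ξ/(320 A log q) ≤ ξ/(40 log N)`
  have hlogN : Real.log ((w ^ 8 : ℕ) : ℝ) ≤ 8 * (A * Real.log q) := by
    rw [log_pow_eight]; linarith
  have hlogN0 : 0 < Real.log ((w ^ 8 : ℕ) : ℝ) := by
    rw [log_pow_eight]
    have : 0 < Real.log w := Real.log_pos (by exact_mod_cast (show 1 < w by omega))
    linarith
  calc c / Real.log q ≤ ξ / (320 * A) / Real.log q :=
        div_le_div_of_nonneg_right (min_le_right _ _) hlogq0.le
    _ = ξ / (40 * (8 * (A * Real.log q))) := by field_simp; ring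
    _ ≤ ξ / (40 * Real.log ((w ^ 8 : ℕ) : ℝ)) :=
        div_le_div_of_nonneg_left hξ.le (by positivity) (by nlinarith)
    _ ≤ δ := hcore

end Literature.Barriers.Parity

end
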